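import Summits.BirchSwinnertonDyer.BirchSwinnertonDyer.Theorems.PrintCFramBottomClassIndexLawFiveLeBorelH1Vanishing
import Summits.BirchSwinnertonDyer.BirchSwinnertonDyer.Theorems.PrintCFramBottomClassIndexLawFiveLeBorelNoPTorsion
import HarnessLib

/-!
# Route `PrintCFram`, crux C2 `BottomClassIndexLawFiveLe` (stmt-BirchSwinnertonDyer-20372), line `eisenstein-resource-bdp-line`
# (registry v10), research stub `stub_kolyvaginUpper_borelCM_pairSum_offKrizLi` (S2): GJPST Prop. 5.2 AT THE BOREL CM-RAMIFIED PRIME over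
# EVERY number field `L` GALOIS over `ℚ` and UNRAMIFIED at `p` — the ring class fields `K''_n`, `(n, p) = 1`, of Kolyvagin's
# derivative classes — at every level `p^M`: a central homothety, `H¹(L(E[p^M])/L, E[p^M]) = 0`, `E[p^M]^{Γ_L} = 0`

Cell `bsd-print-cfram`, width seat `bsd-line-cfram-p1-w7` (g0); helper `--supports stmt-BirchSwinnertonDyer-20372`; item «(α) over the
ring class fields `K''_n`» of w2 g5's crux notes `Lines/eisenstein-resource-bdp-line-w2g5-notes.md` §3 (listed there as NOT DONE, size S).
THEOREMS ONLY (0 definitions, 0 named facts, 0 instances, no `sorry`). HONEST FRAMING: nothing about BSD is proved; the stub S2 is NOT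
closed (its visibility step and the Euler-system leaves at the additive prime are research); BSD is not proved by any of this; no summit
statement is proved by this seat.

## What

w2 g5's `BorelHomothety.exists_central_homothety_of_cmRamified` / `subgroupResKer_torsionFixing_eq_bot_of_cmRamified` /
`geomTorsion_eq_zero_of_forall_smul_eq_of_cmRamified` (p637675) give (α) «`H¹(K(E[p^M])/K, E[p^M]) = 0`» and «`E[p^M]^{Γ_K} = 0`» over
every QUADRATIC `K` (route I: w4 g2's inertia homothety is a square of `Γ_ℚ`, hence restricts from `Γ_K`). Kolyvagin's derivative classes live
over the ring class fields `K''_n` — Galois over `ℚ`, unramified at `p` for `(n, p·d_{K''}) = 1`. This file runs route I over them, and more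
generally over any number field `L` for which ONE inertia group at `p` restricts from `Γ_L` (w4 g2's ENGINE FORM
`BorelTorsion.torsionBy_eq_bot_of_inertia_le_range`):

* `exists_central_homothety_of_inertia_le_range` — `W` CM, `CMRamified W p`, `5 ≤ p`, `L` ANY number field, `𝔓 ∣ p` a prime of `ℤ̄` with
  `I_𝔓 ≤ res(Γ_L)`, `M ≥ 1` ⟹ `∃ g₀ ∈ Γ_L, d` with `(d − 1, p^M) = 1` and `g₀` acting on `E[p^M] ⊂ E(L̄)` as `d` (w4 g2's
  `exists_sq_mem_inertia_homothety` + w2 g5's lift `homothety_pow_of_level_one`);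
* `subgroupResKer_torsionFixing_eq_bot_of_inertia_le_range` (GJPST Prop. 5.2: restriction `H¹(L, E[p^M]) → H¹(L(E[p^M]), E[p^M])`
  injective, Sah via `subgroupResKer_torsionFixing_eq_bot_of_smul_eq`) and `geomTorsion_eq_zero_of_forall_smul_eq_of_inertia_le_range`
  (`E[p^M]^{Γ_L} = 0`);
* the GALOIS-UNRAMIFIED readings `exists_central_homothety_of_isGalois_of_isUnramifiedIn`,
  **`subgroupResKer_torsionFixing_eq_bot_of_isGalois_of_isUnramifiedIn`**, **`geomTorsion_eq_zero_of_forall_smul_eq_of_isGalois_of_isUnramifiedIn`**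
  (`L/ℚ` finite Galois in `Type`, unramified above `p`: `I_𝔓 ≤ res(Γ_L)` by the tree's `inertia_le_range_absGaloisRestrict_of_isUnramifiedIn`).

References: [GrigorovJorzaPatrikisSteinTarnita2009] Props. 5.2, 5.4 (Math. Comp. 78, p. 2415); [GrossLMS1991] §4 Lemma 4.3, §9;
[Rubin1999] Lemma 6.2; [SerreLocalFields1979] IV §4 Prop. 17–18, VII §8.
-/

set_option autoImplicit false
-- the summit namespace `Summit.BirchSwinnertonDyer.BirchSwinnertonDyer` repeats the problem name by design (D-0017)
set_option linter.dupNamespace false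

noncomputable section

open scoped Classical

namespace Summit.BirchSwinnertonDyer.BirchSwinnertonDyer.Theorems.PrintCFram.BorelHomothetyUnramified

open WeierstrassCurve NumberField Field IsDedekindDomain
  Literature.NumberTheory.EllipticCurves Literature.NumberTheory.EllipticCurves.Rank1Residual
  Literature.NumberTheory.GaloisRepresentations
  Summit.BirchSwinnertonDyer.Rank1Residual
  Summit.BirchSwinnertonDyer.BirchSwinnertonDyer.Theorems.PrintCFram

variable (W : WeierstrassCurve ℚ) [W.IsElliptic] (p : ℕ) [hp : Fact p.Prime]
  (L : Type) [Field L] [NumberField L]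

/-! ## §1 Engine form: one inertia group at `p` restricts from `Γ_L` -/

/-- **The central homothety at every level `p^M`, engine form.** For `W/ℚ` with CM, `p ≥ 5` CM-ramified, a number field `L`, a prime
`𝔓 ∣ p` of `ℤ̄` with `I_𝔓 ≤ res(Γ_L)`, and `M ≥ 1`: some `g₀ ∈ Γ_L` acts on `E[p^M] ⊂ E(L̄)` as an integer `d` with `(d − 1, p^M) = 1`
(w4 g2's inertia homothety at level `p`, restricted from `Γ_L`, then lifted by w2 g5's `homothety_pow_of_level_one`).
[cite: GrigorovJorzaPatrikisSteinTarnita2009, Prop. 5.4 (mechanism)] [cite: SerreLocalFields1979, Ch. IV §4, Prop. 17–18] -/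
theorem exists_central_homothety_of_inertia_le_range (hCM : W.HasCM) (h5 : 5 ≤ p) (hram : CMRamified W p)
    {v : HeightOneSpectrum (𝓞 ℚ)} (hv : ((p : ℕ) : 𝓞 ℚ) ∈ v.asIdeal)
    {𝔓 : Ideal (absIntegers (𝓞 ℚ) ℚ)} (h𝔓 : 𝔓 ∈ v.primesAbove)
    (hI : 𝔓.inertia (absoluteGaloisGroup ℚ) ≤ (absGaloisRestrict ℚ L).range) {M : ℕ} (hM : 1 ≤ M) :
    ∃ (g₀ : absoluteGaloisGroup L) (d : ℤ), IsCoprime (d - 1) ((p ^ M : ℕ) : ℤ) ∧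
      ∀ P : geomTorsion (W.baseChange L) ((p ^ M : ℕ) : ℤ), g₀ • P = d • P := by
  obtain ⟨g, hgI, -, c, hc1, hg⟩ :=
    BorelTorsion.exists_sq_mem_inertia_homothety (W := W) (p := p) hCM h5 hram hv h𝔓
  obtain ⟨σ, hσ⟩ := hI hgI
  have hσg : absGaloisRestrict ℚ L σ = g := hσ
  have hσ' : ∀ x : W.geomPoints, p • x = 0 → absGaloisRestrict ℚ L σ • x = c • x := fun x hx => by
    have hx' := congrArg Subtype.val (hg ⟨x, AddSubgroup.torsionBy.nsmul_iff.mpr hx⟩)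
    rw [hσg]
    exact hx'
  obtain ⟨hcop, hpow⟩ := BorelHomothety.homothety_pow_of_level_one W p L hc1 hσ' hM
  exact ⟨σ ^ (p ^ (M - 1)), c ^ (p ^ (M - 1)), hcop, hpow⟩

/-- **GJPST Prop. 5.2 at the Borel CM-ramified prime, engine form: `H¹(L(E[p^M])/L, E[p^M]) = 0`** — the restriction
`H¹(L, E[p^M]) → H¹(L(E[p^M]), E[p^M])` is injective — for every number field `L` with `I_𝔓 ≤ res(Γ_L)` for one `𝔓 ∣ p`, every `M ≥ 1`
(Sah's lemma with the central homothety, w2 g5's `subgroupResKer_torsionFixing_eq_bot_of_smul_eq`).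
[cite: GrigorovJorzaPatrikisSteinTarnita2009, Prop. 5.2 and Prop. 5.4] [cite: Rubin1999, Lemma 6.2 (i)] -/
theorem subgroupResKer_torsionFixing_eq_bot_of_inertia_le_range (hCM : W.HasCM) (h5 : 5 ≤ p) (hram : CMRamified W p)
    {v : HeightOneSpectrum (𝓞 ℚ)} (hv : ((p : ℕ) : 𝓞 ℚ) ∈ v.asIdeal)
    {𝔓 : Ideal (absIntegers (𝓞 ℚ) ℚ)} (h𝔓 : 𝔓 ∈ v.primesAbove)
    (hI : 𝔓.inertia (absoluteGaloisGroup ℚ) ≤ (absGaloisRestrict ℚ L).range) {M : ℕ} (hM : 1 ≤ M) :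
    subgroupResKer (geomTorsion (W.baseChange L) ((p ^ M : ℕ) : ℤ))
      (torsionFixing (W.baseChange L) ((p ^ M : ℕ) : ℤ)) = ⊥ := by
  obtain ⟨g₀, d, hd, hg⟩ := exists_central_homothety_of_inertia_le_range W p L hCM h5 hram hv h𝔓 hI hM
  haveI : (W.baseChange L).IsElliptic := by unfold WeierstrassCurve.baseChange; infer_instance
  exact BorelHomothety.subgroupResKer_torsionFixing_eq_bot_of_smul_eq (W.baseChange L) (pow_ne_zero M hp.out.ne_zero) hg hd

/-- **`E[p^M]^{Γ_L} = 0`, engine form** (every number field `L` with `I_𝔓 ≤ res(Γ_L)` for one `𝔓 ∣ p`, every `M ≥ 1`).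
[cite: GrigorovJorzaPatrikisSteinTarnita2009, Prop. 5.2] [cite: GrossLMS1991, §4 Lemma 4.3] -/
theorem geomTorsion_eq_zero_of_forall_smul_eq_of_inertia_le_range (hCM : W.HasCM) (h5 : 5 ≤ p) (hram : CMRamified W p)
    {v : HeightOneSpectrum (𝓞 ℚ)} (hv : ((p : ℕ) : 𝓞 ℚ) ∈ v.asIdeal)
    {𝔓 : Ideal (absIntegers (𝓞 ℚ) ℚ)} (h𝔓 : 𝔓 ∈ v.primesAbove)
    (hI : 𝔓.inertia (absoluteGaloisGroup ℚ) ≤ (absGaloisRestrict ℚ L).range) {M : ℕ} (hM : 1 ≤ M)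
    (P : geomTorsion (W.baseChange L) ((p ^ M : ℕ) : ℤ)) (hP : ∀ σ : absoluteGaloisGroup L, σ • P = P) : P = 0 := by
  obtain ⟨g₀, d, hd, hg⟩ := exists_central_homothety_of_inertia_le_range W p L hCM h5 hram hv h𝔓 hI hM
  exact BorelHomothety.eq_zero_of_forall_smul_eq_of_smul_eq (W.baseChange L) hg hd P (hP g₀)

/-! ## §2 The ring class fields: `L/ℚ` finite Galois, unramified at `p` -/

/-- **The central homothety over every Galois `L/ℚ` unramified at `p`** (e.g. the ring class fields `K''_n`, `(n, p·d_{K''}) = 1`, of a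
Heegner field `K''`), every level `p^M`: `I_𝔓 ≤ res(Γ_L)` by the tree's `inertia_le_range_absGaloisRestrict_of_isUnramifiedIn`.
[cite: GrigorovJorzaPatrikisSteinTarnita2009, Prop. 5.4 (mechanism)] [cite: SerreLocalFields1979, Ch. VII §8 Application] -/
theorem exists_central_homothety_of_isGalois_of_isUnramifiedIn (hCM : W.HasCM) (h5 : 5 ≤ p) (hram : CMRamified W p)
    [IsGalois ℚ L]
    (hunr : ∀ v : HeightOneSpectrum (𝓞 ℚ), ((p : ℕ) : 𝓞 ℚ) ∈ v.asIdeal → Algebra.IsUnramifiedIn (𝓞 L) v.asIdeal)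
    {M : ℕ} (hM : 1 ≤ M) :
    ∃ (g₀ : absoluteGaloisGroup L) (d : ℤ), IsCoprime (d - 1) ((p ^ M : ℕ) : ℤ) ∧
      ∀ P : geomTorsion (W.baseChange L) ((p ^ M : ℕ) : ℤ), g₀ • P = d • P := by
  obtain ⟨v, hv, 𝔓, h𝔓⟩ := BorelTorsion.exists_place_mem_and_primesAbove p
  exact exists_central_homothety_of_inertia_le_range W p L hCM h5 hram hv h𝔓
    (inertia_le_range_absGaloisRestrict_of_isUnramifiedIn (K := L) (hunr v hv) h𝔓) hM

/-- **GJPST Prop. 5.2 over the ring class fields: `H¹(L(E[p^M])/L, E[p^M]) = 0`** for `W/ℚ` with CM, `p ≥ 5` CM-ramified, every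
finite Galois `L/ℚ` unramified at `p`, every `M ≥ 1` — the restriction step of Kolyvagin's argument over `K''_n` at the Borel prime, where
`ρ̄_{W,p}` is reducible and GJPST's `E(K_n)[p] = 0`/surjectivity inputs are unavailable.
[cite: GrigorovJorzaPatrikisSteinTarnita2009, Props. 5.2–5.4 (Math. Comp. 78, p. 2415)] [cite: GrossLMS1991, §4 Lemma 4.3] -/
theorem subgroupResKer_torsionFixing_eq_bot_of_isGalois_of_isUnramifiedIn (hCM : W.HasCM) (h5 : 5 ≤ p) (hram : CMRamified W p)
    [IsGalois ℚ L]
    (hunr : ∀ v : HeightOneSpectrum (𝓞 ℚ), ((p : ℕ) : 𝓞 ℚ) ∈ v.asIdeal → Algebra.IsUnramifiedIn (𝓞 L) v.asIdeal)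
    {M : ℕ} (hM : 1 ≤ M) :
    subgroupResKer (geomTorsion (W.baseChange L) ((p ^ M : ℕ) : ℤ))
      (torsionFixing (W.baseChange L) ((p ^ M : ℕ) : ℤ)) = ⊥ := by
  obtain ⟨v, hv, 𝔓, h𝔓⟩ := BorelTorsion.exists_place_mem_and_primesAbove p
  exact subgroupResKer_torsionFixing_eq_bot_of_inertia_le_range W p L hCM h5 hram hv h𝔓
    (inertia_le_range_absGaloisRestrict_of_isUnramifiedIn (K := L) (hunr v hv) h𝔓) hM

/-- **`E[p^M]^{Γ_L} = 0` over the ring class fields** (every finite Galois `L/ℚ` unramified at `p`, every `M ≥ 1`).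
[cite: GrigorovJorzaPatrikisSteinTarnita2009, Prop. 5.2] [cite: GrossLMS1991, §4 Lemma 4.3] -/
theorem geomTorsion_eq_zero_of_forall_smul_eq_of_isGalois_of_isUnramifiedIn (hCM : W.HasCM) (h5 : 5 ≤ p) (hram : CMRamified W p)
    [IsGalois ℚ L]
    (hunr : ∀ v : HeightOneSpectrum (𝓞 ℚ), ((p : ℕ) : 𝓞 ℚ) ∈ v.asIdeal → Algebra.IsUnramifiedIn (𝓞 L) v.asIdeal)
    {M : ℕ} (hM : 1 ≤ M)
    (P : geomTorsion (W.baseChange L) ((p ^ M : ℕ) : ℤ)) (hP : ∀ σ : absoluteGaloisGroup L, σ • P = P) : P = 0 := by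
  obtain ⟨v, hv, 𝔓, h𝔓⟩ := BorelTorsion.exists_place_mem_and_primesAbove p
  exact geomTorsion_eq_zero_of_forall_smul_eq_of_inertia_le_range W p L hCM h5 hram hv h𝔓
    (inertia_le_range_absGaloisRestrict_of_isUnramifiedIn (K := L) (hunr v hv) h𝔓) hM P hP

end Summit.BirchSwinnertonDyer.BirchSwinnertonDyer.Theorems.PrintCFram.BorelHomothetyUnramified

end
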